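import Summits.QuantumFields.YangMills.Theorems.BalabanUVNodesN19RateEdgeHolderD4
import Summits.QuantumFields.YangMills.Theorems.BalabanUVNodesN19RateEdgeRecordRunLettersTuned

/-!
# BalabanUVNodes ∕ N19 — K3⁷ v2's N19′ SLOT UNDER THE `ForSmallCouplings` PREFIX, MODULO THE LINK READING AT THE RUNS OF RECORD: J's shorter `hlink`
# with the (v′-17) run letters `g` PINNED to the window-extended runs `runFlow D g₀ K` of a TUNED bare sequence — seven more conjuncts of the link reading
# discharged BY NAME (dag-n19-w3 g0's run letters from tuning), the reading's ledger now read at the ACTUAL effective couplings of the construction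

Cell `pub-ymgap`, HUMAN RULING D-0062 (Track A) + D-0149 (work-bound push, director-ym №197), WIDTH SEAT `pub-ymgap-dag-n19-w3` (N19 NE7, seat 3 of 3),
generation g2; bus CLAIM + INTENT-1 (pub-ymgap INBOX l.25990).  Route `Summits/QuantumFields/YangMills/Theses/BalabanUVNodes.lean` rev 25, cluster item K3⁷
«SpineGivenEndpointR13SepCoPH» (stmt-QuantumFields-20544), plan g79's registered skeleton v2 145a664ea9c38a7b (N19′'s slot `KeyedCoreEdgeHolderD4 β cr (rrOfRecord 𝔯 ksel)`
at the rates predicate `PHolderD4 β D R := RatesHolderAt D R β ∧ ReadOutAt D R.u3 ∧ (0 ≤ R.u3.ρ ∧ R.u3.ρ < 1)`; its extraction slot `KeyedExtraction` and the item's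
conclusion `HybridNE7Under D Hβ = (B) → Hβ → ForSmallCouplings D …` live UNDER THE PREFIX); filed `--kind proof --supports` that item `--as helper` (it proves no
registered stub).  COUNT-NEUTRAL.  THEOREMS ONLY; 0 `def`; 0 `sorry`; `N`-generic, guard-generic `G`, reading-generic `cr` exactly as J; NO Theses import.
Imports J `…N19RateEdgeHolderD4` (dag-n19-d p589854; brings E `…N19RateEdgeHolder` and this seat's `…N19RateEdgeRecordRunLetters`) and this seat's `…RunLettersTuned`
(g0 p586951: `rgEqH_runFlow_datumOfRecord₁₃CoPH_of_tuned`, `invSq_le_of_rgEqH_along`, `betaAlong_runFlow_le_of_betaBoundsInInterval`) — CITED BY NAME, none edited.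

THE SITUATION (dag-n19-d's LOCATED DESIGN NOTE, pub-ymgap INBOX l.25428 ∕ l.25666).  J's `h19HolderD4_datumOfRecord₁₃CoPH_of_linkReading` displays the N19′ slot modulo a
link reading that still ∃-BINDS the run letters `g : ℕ → ℕ → ℝ`, `gIR`, `β′_T` subject to SEVEN run clauses — the (0.20)-run identification `∀ K, RGEqH K D.βfun (g K)`,
the infrared pin `∀ K, g K K = gIR`, the box `∀ K i ≤ K, 0 < g K i ≤ R.u3.γ`, both window memberships, (T)'s upper running `1∕(g K j)² ≤ 1∕gIR² + β′_T·(K − j)` and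
its sign `0 ≤ β′_T`.  This seat's g0 files inhabit all seven AT THE ₁₃ RECORD BUNDLE for the runs of record of a bare sequence TUNED within `]0, γ]`, `γ ≤ θ.γ`
(`D.Tuned γ gIR g₀`; NO β-side letter for six of them — the datum of record HALTS OUTSIDE; the upper running from a bound `β ≤ b′` along the runs) — but v2's
slot quantifies over EVERY `g₀`, so at the slot as typed they stay displayed.  The K3⁷ item's OWN conclusion and its extraction slot are under the
`ForSmallCouplings` prefix (only tuned bare sequences are ever read); this file types the N19′ face there, AT THE RUNS OF RECORD: an ∃-chosen `g` lets a link
reading book NODE O's ledger against couplings that are not the construction's; the pin removes that freedom.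

WHAT THIS FILE PROVES (`R := rateCarriersOfRecord₁₃CoPH 𝔯 F θ hP g₀ os k`, `D := datumOfRecord₁₃CoPH F N θ hP`, `S := cr F θ hP g₀ os`).
* §1 (generic datum) `runClauses_of_pinnedRuns_tuned` — for ANY `g` agreeing with `runFlow D g₀ K` up to the cutoff and equal to `gIR` beyond (the two PIN
  clauses), tuning within `]0, γ]` and (0.20) along the runs of record give the run identification, the infrared pin, the box and both window memberships at
  any radius `γ′ ≥ γ`, and `0 < gIR ≤ γ`; `invSq_of_pinnedRuns_along` — (T)'s upper running at the pinned `g` with `β′_T := max b′ 0` from `β ≤ b′` along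
  the runs.  [folklore]
* §2 ★★ `h19HolderD4_datumOfRecord₁₃CoPH_of_linkReadingAtRuns_tuned` — IF the link reading AT THE RUNS OF RECORD `hlink` holds at every guarded admissible
  tuple and every bare sequence tuned within `]0, γ]`, `γ ≤ θ.γ`, THEN at every such tuple ∕ sequence with `β ≤ b′` along its runs of record, every `os k`:
  `RatesHolderAt D R β ∧ ReadOutAt D R.u3 ∧ (0 ≤ R.u3.ρ ∧ R.u3.ρ < 1) → ∃ δ, NE7.Core S.l₀ S.vol S.T S.Bad (S.A − S.shA) (S.B − S.shB) δ ∧ Summable δ`.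
  `hlink` = J's clause (its l.94–229) with the binders `gIR`, `β′_T` REMOVED from the ∃ (`gIR` is the tuned infrared value), the SEVEN run conjuncts above
  REMOVED, and TWO pin conjuncts ADDED right after the binders: `(∀ K i, i ≤ K → g K i = runFlow D g₀ K i) ∧ (∀ K i, K < i → g K i = gIR)`.  Everything
  else — the tuple letter `θ.γ² ≤ e⁻¹`, (i) the ledger predicate, `0 ≤ S.vol`, (ii-m), (iii) [III] Thm 2 (2.43), (iv) N14's count, (ii-v-A∕B), (ii-d),
  (v′-16), (v′-17)'s β-window ∕ smallness ∕ `0 < ρ ≤ θc`, (T)'s `DecayBound` ∕ pair discs ∕ constants, the selector clause — is BYTE-IDENTICAL to J.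
  Proof: E at the same-tuple pair predicate carrying `ReadOutAt ∧ ρ < 1` (as J) AND the tuning ∕ `γ ≤ θ.γ` ∕ along-history bound; v9's clause REASSEMBLED
  (as J) from `hlink`, J's seven named facts, and §1's seven run clauses at the pinned `g` (`rgEqH_runFlow_datumOfRecord₁₃CoPH_of_tuned` BY NAME).
* §3 ★★ `forSmallCouplings_h19HolderD4_datumOfRecord₁₃CoPH_of_linkReadingAtRuns` — the same UNDER THE CRUX's PREFIX BY NAME: given K1⁷'s interval-form
  window `BetaBoundsInInterval D.C.toB12 γ₀ b b′` at the tuple (N24's binder; g0's `betaAlong_runFlow_le_of_betaBoundsInInterval`), `ForSmallCouplings D (fun g₀ =>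
  ∀ os k, PHolderD4 β D R → ∃ δ, NE7.Core S … δ ∧ Summable δ)` with threshold `γ₀′ := min γ₀ θ.γ` (the `g`-threshold idle); ★ `…_keyed` — at a run-length
  selector `ks` (v2's slot text under the prefix, unfolded).
Under the prefix N19's displayed residual is J's list MINUS the run letters; dag-n19-d's K (`…D4AtSpineReadingV`, the V reading) removes (ii-m)'s four lattice
clauses on the same pattern — the two edits commute (generic `cr` here).

HONEST FRAMING.  Count-neutral kernel bookkeeping (one reassembly + applications); `hlink` is a HYPOTHESIS (NODE O's world; 0 instances in the tree); `D.Tuned γ gIR g₀`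
(K2⁷'s ∕ [B12] Thm 2's content at the datum of record) and `BetaBoundsInInterval` (K1⁷'s β-window binder; upper half printed [Balaban1987RG1] (1.22) p. 264 with proof
deferred, lower half UNPRINTED) are HYPOTHESES; the rates predicate is the slot's own hypothesis; `cr 𝔯 G` PARAMETERS.  NOT a proof of `stub_expansion13H`; no skeleton
text is touched and no v3 is proposed here (plan's call, l.25428).  NE7 for Bałaban's two runs is NOT PRINTED and NOT proved; nothing of Bałaban's is asserted or
instantiated (K0⁷ OPEN); N19 NOT discharged; K3⁷ NOT claimed; Track A count unmoved (typed 28∕28 · discharged 5∕27 · A 5∕28).  One finite four-torus at fixed ε, rung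
(B)+1 — R4 closes the CONDITIONAL finite-𝕋⁴ rung `BalabanLadder.UV` only; NOT infinite volume, NOT OS on ℝ⁴, NOT a mass gap; the YM mass gap (Clay) is NOT proved by
any of this.  Standard axioms.  Supersedes nothing; edits nothing.  Shape reference: [Balaban1987RG1] Thm 2 p. 259 (the NAME of the hypothesis `D.Tuned` — nothing asserted).
-/

set_option autoImplicit false

noncomputable section

open Finset MeasureTheory
open scoped BigOperators Matrix Matrix.Norms.L2Operator

namespace Summit.QuantumFields.YangMills.BalabanUVNodes.N19RateEdgeHolderD4AtRuns

open Literature.MathematicalPhysics.QuantumFieldTheory.Balaban1983to89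
open T4OutputRate T4RecentScale T4GoodClassBudget T4CauchySum T4TowerRateComposition T4TowerRateDischarge
open T4EtaRateMin (Readings NE3Shape)
open T4RateLiaison (GaugeDominated)
open T4CouplingMatching (EventualLowerH)
open FlowStep (RGEqH prefixOf)
open TreeLengthTorus (TFaceConnected torusTreeLen)
open B12TreeDecay (kappa₀)
open Summit.QuantumFields.BalabanUV.T4Continuum
open AveragingDeficitDualResidual (dualC1 dualC2)
open AveragingDeficitDerivWallProof (wallConst)
open AveragingDeficitPeriodicCounting (IsPeriodicDir)
open MinimalActionSandwich (IsMinimiser minAct)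
open MinimalActionRate (sfClass)
open MinimalActionRefine (RegularSup gradConst)
open NE3EnergyShapes (IsUnitarySite IsPeriodicSite)
open NE3.LeafIndexSockets (LeafH3sup)
open Summit.QuantumFields.BalabanUV.T4Continuum.Spine
open Summit.QuantumFields.BalabanUV.T4Continuum.Spine.NE4 (runFlow box_and_pin_of_tuned)
open Summit.QuantumFields.BalabanUV.T4Continuum.NE1p.DressedRoot (DressedTower DressedStabilityStrict)
open Summit.QuantumFields.YangMills.BalabanUVNodes.N19LedgerLinkSync (LedgerDataSync LedgerAtSync)
open YMDAG.UVSplit (SpineCarriers SpineRecordPred InputsPred U3Carriers RateCarriers RateRecordPred N14At N18At N22At ReadOutAt)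
open Summit.QuantumFields.YangMills.BalabanUVNodes.N16HolderDefs (CovRootHolder N16HolderAt)
open Summit.QuantumFields.YangMills.BalabanUVNodes.SpineRatesHolder (RatesHolderAt)
open Literature.MathematicalPhysics.QuantumFieldTheory.Balaban1983to89.T4Continuum (T4Family ULoop)
open T4WeightBudget (RelWeightBound)
open T4IndicatorShell (ShellWeightBound)
open T4ContinuumYM4Torus (ForSmallCouplings)
open T4ApexHybrid (HybridNE7Under)
open YMDAG.UVSplit (Datum RateReading₁₃CoPH rateCarriersOfRecord₁₃CoPH)
open YMDAG.UVSplit (SpineReading₁₃CoPH ShellSplit₁₃CoPH)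
open Node00 (Stage13HParams datumOfRecord₁₃CoPH SiteSeqKey)
open Summit.QuantumFields.YangMills.BalabanUVNodes.N19RateEdgeHolder (rateEdge_of_linkReading_byName_pairDiscC1Holder)
open Summit.QuantumFields.YangMills.BalabanUVNodes.N19RateEdgeRecordRunLetters
  (rgEqH_congr two_le_ne3_L_rateCarriersOfRecord₁₃CoPH signs_rateCarriersOfRecord₁₃CoPH_of_readOutAt window_rateCarriersOfRecord₁₃CoPH_sq_le_exp_neg_one
    gamma_pos_rateCarriersOfRecord₁₃CoPH)
open Summit.QuantumFields.YangMills.BalabanUVNodes.N19RateEdgeRecordRunLettersTuned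
  (invSq_le_of_rgEqH_along rgEqH_runFlow_datumOfRecord₁₃CoPH_of_tuned betaAlong_runFlow_le_of_betaBoundsInInterval)

/-! ## §1 Generic datum: the run clauses of ANY `g` PINNED to the window-extended runs of a tuned bare sequence -/

section Pinned

variable {F : T4Family} {N : ℕ} [NeZero N]

/-- **THE β-FREE RUN CLAUSES AT THE PINNED RUNS** [folklore]: for a bare sequence TUNED to `gIR` within `]0, γ]` (`D.Tuned γ gIR g₀`), the history recursion
(0.20) along its runs of record (`hrg`; at the ₁₃ `CoPH` datum of record this is `rgEqH_runFlow_datumOfRecord₁₃CoPH_of_tuned`, NO β-side letter), and ANY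
`g : ℕ → ℕ → ℝ` that AGREES with `runFlow D g₀ K` up to the cutoff (`hle`) and EQUALS `gIR` beyond it (`hgt`): the (0.20)-run identification, the infrared
pin, the box and BOTH window memberships (at every index) hold at any radius `γ′ ≥ γ`, and `0 < gIR ≤ γ`.  (`rgEqH_congr`, `box_and_pin_of_tuned`.) -/
theorem runClauses_of_pinnedRuns_tuned (D : Datum F N) {γ gIR γ' : ℝ} {g₀ : ℕ → ℝ} {g : ℕ → ℕ → ℝ}
    (hrg : ∀ K, RGEqH K D.βfun (runFlow D g₀ K)) (ht : D.Tuned γ gIR g₀) (hγle : γ ≤ γ')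
    (hle : ∀ K i, i ≤ K → g K i = runFlow D g₀ K i) (hgt : ∀ K i, K < i → g K i = gIR) :
    (∀ K, RGEqH K D.βfun (g K)) ∧ (∀ K, g K K = gIR) ∧
      (∀ K i, i ≤ K → 0 < g K i ∧ g K i ≤ γ') ∧
      (∀ K, g K ∈ Window γ') ∧ (∀ K, (fun i => g (K + 1) (i + 1)) ∈ Window γ') ∧ 0 < gIR ∧ gIR ≤ γ := by
  obtain ⟨hbox, hpin⟩ := box_and_pin_of_tuned D ht
  have hIR : 0 < gIR ∧ gIR ≤ γ := by
    have h := hbox 0 0 le_rfl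
    rwa [hpin 0] at h
  -- one index of one pinned run: in the box up to the cutoff, the infrared value beyond
  have hval : ∀ K i, 0 < g K i ∧ g K i ≤ γ' := by
    intro K i
    rcases le_or_gt i K with hi | hi
    · rw [hle K i hi]
      exact ⟨(hbox K i hi).1, (hbox K i hi).2.trans hγle⟩
    · rw [hgt K i hi]
      exact ⟨hIR.1, hIR.2.trans hγle⟩
  refine ⟨fun K => rgEqH_congr (hrg K) (hle K), fun K => (hle K K le_rfl).trans (hpin K), fun K i _ => hval K i,
    fun K i => hval K i, fun K i => hval (K + 1) (i + 1), hIR.1, hIR.2⟩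

/-- **(T)'s UPPER RUNNING AT THE PINNED RUNS** [folklore]: with a bound `β ≤ b′` ALONG THE RUNS OF RECORD (`halong`; from K1⁷'s interval-form window by
`betaAlong_runFlow_le_of_betaBoundsInInterval`, or from the printed box bound), tuning and (0.20) along the runs, ANY `g` agreeing with `runFlow D g₀ K` up to
the cutoff satisfies `1∕(g K j)² ≤ 1∕gIR² + max(b′, 0)·(K − j)` for `j ≤ K` (telescoped (0.20), `invSq_le_of_rgEqH_along`; the sign letter `0 ≤ max b′ 0` is free). -/
theorem invSq_of_pinnedRuns_along (D : Datum F N) {γ gIR b' : ℝ} {g₀ : ℕ → ℝ} {g : ℕ → ℕ → ℝ}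
    (hrg : ∀ K, RGEqH K D.βfun (runFlow D g₀ K)) (halong : ∀ K i, i < K → D.βfun i (prefixOf (runFlow D g₀ K) i) ≤ b')
    (ht : D.Tuned γ gIR g₀) (hle : ∀ K i, i ≤ K → g K i = runFlow D g₀ K i) :
    ∀ K j, j ≤ K → 1 / g K j ^ 2 ≤ 1 / gIR ^ 2 + max b' 0 * ((K : ℝ) - j) := by
  intro K j hj
  have h := invSq_le_of_rgEqH_along (β'T := max b' 0) (hrg K) (fun i hi => (halong K i hi).trans (le_max_left b' 0)) hj
  rw [(box_and_pin_of_tuned D ht).2 K] at h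
  rw [hle K j hj]
  exact h

end Pinned

/-! ## §2 The link reading AT THE RUNS OF RECORD on tuned bare sequences ⇒ N19′'s edge GIVEN `PHolderD4 β` -/

section AtRecordRuns

variable {N : ℕ} [NeZero N]
  (cr : (F : T4Family) → (θ : Stage13HParams F N) → θ.Provisos₁₃CoPH F N → (ℕ → ℝ) → List (ULoop F) → SpineCarriers)
  (𝔯 : RateReading₁₃CoPH N) (G : ∀ {F : T4Family}, Stage13HParams F N → Prop) {β : ℝ} (hβ1 : β ≤ 1)
  (hlink : ∀ (F : T4Family) (θ : Stage13HParams F N) (hP : θ.Provisos₁₃CoPH F N), G θ → θ.Admissible F N →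
    ∀ (γ gIR : ℝ) (g₀ : ℕ → ℝ), (datumOfRecord₁₃CoPH F N θ hP).Tuned γ gIR g₀ → γ ≤ θ.γ →
    ∀ (os : List (ULoop F)) (k : ℕ),
      let S : SpineCarriers := cr F θ hP g₀ os
      let R : RateCarriers N := rateCarriersOfRecord₁₃CoPH 𝔯 F θ hP g₀ os k
      let D : Datum F N := datumOfRecord₁₃CoPH F N θ hP
      letI := S.dec
      -- the tuple's window letter (replaces (T)'s clause over `R.u3.W`; dag-n19-w3 `window_rateCarriersOfRecord₁₃CoPH_sq_le_exp_neg_one`)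
      θ.γ ^ 2 ≤ Real.exp (-1) ∧
      ∃ (_ : DecidableEq R.u3.C.Dom) (F' : Type) (ι' X' : Type) (_ : MeasurableSpace ι')
        (L : LedgerDataSync R.u3.C F' ι' S.ι) (Rd : Readings ι' X') (bsel : (ℕ → ℝ) → ℝ) (EB : Functional R.u3.C R.u3.C.BgB)
        (θc θ₃ : ℝ) (g : ℕ → ℕ → ℝ)
        (uA : ℕ → ι' → R.u3.C.BgA) (uB : ℕ → ι' → R.u3.C.BgB)
        (Pf : ℕ → Params) (d₀ L₀ Koff : ℕ) (cells : (K j : ℕ) → R.u3.C.Dom → Finset (Site (Pf K) j))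
        (H033 : Flow → ℕ → Prop) (I : Type) (fam : I → B14.Sect2Data) (Lb βw : ℝ) (κ₁ : ℕ) (Gv Cl : ℝ) (K₁ : ℕ)
        (Λ₀ N₀ : ℝ) (dressed : R.u3.C.Dom → Prop) (_ : DecidablePred dressed)
        -- N16-side letters: regime, selection, reading map, NE7 route-#1 side letters, offset
        (c' t ε₁ θ γ₃ l₁ : ℝ)
        (sel : ℕ → (B7Prop1Explicit.Site 4 → Fin 4 → (Matrix (Fin N) (Fin N) ℂ)ˣ) → (B7Prop1Explicit.Site 4 → Fin 4 → (Matrix (Fin N) (Fin N) ℂ)ˣ))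
        (rd : ι' → (B7Prop1Explicit.Site 4 → Fin 4 → (Matrix (Fin N) (Fin N) ℂ)ˣ)) (k₀ : ℕ)
        -- N17-side letters: β-window (the infrared pin `gIR` is the TUNED value, no longer a binder)
        (bβ : ℝ) (k₀β : ℕ)
        -- TUBE letters of the bracket (T): the (1.18) constant, the layer factor and (2.28)'s `C₁, q₁` (the flow's `β′_T` is no longer a binder)
        (E₀T κ₁T C₁T : ℝ) (q₁ : ℕ),
        -- ★ THE RUNS OF RECORD, window-extended by the infrared value: `g` IS `runFlow D g₀ K` up to the cutoff and `gIR` beyond (replaces the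
        -- (0.20)-run identification, the infrared pin, the box, both window memberships, (T)'s upper running and its sign `0 ≤ β′_T`)
        (∀ K i, i ≤ K → g K i = runFlow D g₀ K i) ∧ (∀ K i, K < i → g K i = gIR) ∧
        -- the run-B functional is the first-coupling family read through the selector
        EB = (fun s => R.u3.EB (bsel s) s) ∧
        -- (i) the ledger predicate for whatever size data and census constants meet their clauses
        (∀ (Sz : ℕ → ℝ → S.ι → ℕ → ℝ) (E₀ : ℝ) (m : ℕ) (a : ℝ) (Cw Λg : ℝ),
          (∀ K t, |t| ≤ S.l₀ → ∀ τ ∈ S.T K \ S.Bad K t, ∀ v ∈ Rd.dom, ∀ j ≤ K,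
            |∑ X ∈ L.fac K t τ with R.u3.C.scale X = j,
                (Real.log (Real.exp (EB (fun i => g (K + 1) (i + 1)) (uB K v) X
                    - EB (fun i => g (K + 1) (i + 1)) L.oneB X))
                  - Real.log (Real.exp (R.u3.EA (g K) (uA K v) X - R.u3.EA (g K) L.oneA X)))| ≤ Sz K t τ j) →
          0 ≤ E₀ → 0 < a → a < 1 →
          (∀ K t, |t| ≤ S.l₀ → ∀ τ ∈ S.T K \ S.Bad K t, ∀ j ≤ K,
            Sz K t τ j ≤ S.vol * (E₀ * ((K : ℝ) + 1) ^ m * a ^ (K - j))) →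
          (∀ K, Multiplicity (L.All K) R.u3.C.scale (fun X => Real.exp (-(R.u3.κ * R.u3.C.d X))) Cw S.vol Λg K) →
          (∀ K t, |t| ≤ S.l₀ → ∀ τ ∈ S.T K \ S.Bad K t,
            WindowMultiplicity (L.facO K t τ) L.scO L.wO Cw S.vol Λg (jlogOf L.Cl K) K) →
          1 ≤ Λg → L.θ' ≤ Λg →
          LedgerAtSync { L with S := Sz, E₀ := E₀, m := m, a := a, Cw := Cw, Λg := Λg } S.l₀ S.vol S.T S.Bad
            (fun K t τ => S.A K t τ - S.shA K t τ) (fun K t τ => S.B K t τ - S.shB K t τ) Rd R.u3.EA EB R.u3.κ g uA uB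
            R.u3.ω θc R.u3.θ θ₃) ∧
        0 ≤ S.vol ∧
        (∀ K t, |t| ≤ S.l₀ → ∀ τ ∈ S.T K \ S.Bad K t,
          WindowMultiplicity (L.facO K t τ) L.scO L.wO L.Cw S.vol L.Λg (jlogOf L.Cl K) K) ∧
        0 ≤ L.Cw ∧ 1 ≤ L.Λg ∧ L.θ' ≤ L.Λg ∧
        -- (ii-m) the reference ledger's lattice identification
        (∀ K, (Pf K).d = d₀) ∧ (∀ K, (Pf K).L = L₀) ∧ (∀ K, (Pf K).K = Koff + K) ∧
        (∀ K, (Fintype.card (Site (Pf K) (Pf K).K) : ℝ) = S.vol) ∧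
        kappa₀ (4 * 2 ^ d₀) (2 * d₀) ≤ R.u3.κ ∧
        (∀ K, ∀ X ∈ L.All K,
          (cells K (R.u3.C.scale X + Koff) X).Nonempty ∧ TFaceConnected (cells K (R.u3.C.scale X + Koff) X)) ∧
        (∀ K j, Set.InjOn (cells K j) ↑((L.All K).filter fun X => R.u3.C.scale X + Koff = j)) ∧
        (∀ K, ∀ X ∈ L.All K, torusTreeLen (cells K (R.u3.C.scale X + Koff) X) ≤ R.u3.C.d X) ∧
        -- (iii) [III] Theorem 2 (2.43) AS PRINTED with window letters
        B14.Thm2Printed H033 fam Lb βw κ₁ ∧ βw < 1 ∧ 0 < βw ∧ 1 < Lb ∧ 1 ≤ Gv ∧ 0 ≤ Cl ∧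
        -- (iv) the positional-count half of N14's pinned pair at a rate `≤ R.ne1.Λ`
        (∀ p K, (R.ne1.𝒯.B p K).PositionalCount fun j k => N₀ * Λ₀ ^ (k - j)) ∧ 0 ≤ N₀ ∧ 0 ≤ Λ₀ ∧ Λ₀ ≤ R.ne1.Λ ∧
        -- (ii-v-A) run A's vacuum slices ↔ printed E-terms
        (∀ K t, |t| ≤ S.l₀ → ∀ τ ∈ S.T K \ S.Bad K t, ∀ v ∈ Rd.dom, ∀ j ≤ K, ∃ (i : I) (w : (fam i).Ω) (j' : ℕ),
          (fam i).flow.SatisfiesRG (fam i).K ∧ H033 (fam i).flow (fam i).K ∧ 1 ≤ j' ∧ j' ≤ (fam i).K ∧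
          (fam i).K - j' = K - j ∧ (fam i).K ≤ K + K₁ ∧
          (∀ n, 0 ≤ (fam i).gammaVol n w) ∧ (fam i).gammaVol (fam i).K w ≤ S.vol ∧
          (∀ n, n < (fam i).K → n < jlogOf Cl (fam i).K → (fam i).gammaVol n w = 0) ∧
          (∀ n, n < (fam i).K → jlogOf Cl (fam i).K ≤ n → (fam i).gammaVol n w ≤ S.vol * Gv ^ ((fam i).K - n)) ∧
          |∑ X ∈ (L.fac K t τ).filter (fun X => ¬ dressed X) with R.u3.C.scale X = j,
              (R.u3.EA (g K) (uA K v) X - R.u3.EA (g K) L.oneA X)| ≤ |(fam i).eTerm j' (fam i).K w|) ∧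
        -- (ii-v-B) run B's vacuum slices ↔ printed E-terms
        (∀ K t, |t| ≤ S.l₀ → ∀ τ ∈ S.T K \ S.Bad K t, ∀ v ∈ Rd.dom, ∀ j ≤ K, ∃ (i : I) (w : (fam i).Ω) (j' : ℕ),
          (fam i).flow.SatisfiesRG (fam i).K ∧ H033 (fam i).flow (fam i).K ∧ 1 ≤ j' ∧ j' ≤ (fam i).K ∧
          (fam i).K - j' = K - j ∧ (fam i).K ≤ K + K₁ ∧
          (∀ n, 0 ≤ (fam i).gammaVol n w) ∧ (fam i).gammaVol (fam i).K w ≤ S.vol ∧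
          (∀ n, n < (fam i).K → n < jlogOf Cl (fam i).K → (fam i).gammaVol n w = 0) ∧
          (∀ n, n < (fam i).K → jlogOf Cl (fam i).K ≤ n → (fam i).gammaVol n w ≤ S.vol * Gv ^ ((fam i).K - n)) ∧
          |∑ X ∈ (L.fac K t τ).filter (fun X => ¬ dressed X) with R.u3.C.scale X = j,
              (EB (fun i => g (K + 1) (i + 1)) (uB K v) X - EB (fun i => g (K + 1) (i + 1)) L.oneB X)|
            ≤ |(fam i).eTerm j' (fam i).K w|) ∧
        -- (ii-d) the dressed sub-ledger ↔ N14's bookings on `R.ne1.𝒯`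
        (∀ K t, |t| ≤ S.l₀ → ∀ τ ∈ S.T K \ S.Bad K t, ∀ v ∈ Rd.dom,
          ∃ (pA : R.ne1.P) (βA : R.u3.C.Dom → (R.ne1.𝒯.B pA K).Birth) (Q : Finset (R.ne1.𝒯.B pA K).Cube) (pB : R.ne1.P)
            (KB : ℕ) (βB : R.u3.C.Dom → (R.ne1.𝒯.B pB KB).Birth),
          (∀ X ∈ (L.fac K t τ).filter (fun X => dressed X), (R.ne1.𝒯.B pA K).birthScale (βA X) = R.u3.C.scale X) ∧
          (∀ j, Set.InjOn βA ↑(((L.fac K t τ).filter (fun X => dressed X)).filter fun X => R.u3.C.scale X = j)) ∧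
          (∀ c ∈ Q, (R.ne1.𝒯.B pA K).cubeScale c = K) ∧ ((Q.card : ℝ) ≤ S.vol) ∧
          (∀ X ∈ (L.fac K t τ).filter (fun X => dressed X), ∃ c ∈ Q, βA X ∈ (R.ne1.𝒯.B pA K).feltAt c) ∧
          (∀ X ∈ (L.fac K t τ).filter (fun X => dressed X), KB - (R.ne1.𝒯.B pB KB).birthScale (βB X) = K - R.u3.C.scale X) ∧
          (∀ X ∈ (L.fac K t τ).filter (fun X => dressed X),
            |R.u3.EA (g K) (uA K v) X - R.u3.EA (g K) L.oneA X| ≤ (R.ne1.𝒯.B pA K).size (βA X) K) ∧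
          (∀ X ∈ (L.fac K t τ).filter (fun X => dressed X),
            |EB (fun i => g (K + 1) (i + 1)) (uB K v) X - EB (fun i => g (K + 1) (i + 1)) L.oneB X|
              ≤ (R.ne1.𝒯.B pB KB).size (βB X) KB)) ∧
        -- (v′-16) N16 BY NAME: THE END's regime letters of `R.ne3`, N07's interface, the selection, NE7 route-#1's side letters, the
        -- reading map, the action-reading identification, the offset, the gauge-domination convention
        R.ne3.g = gradConst 4 c' ∧ 1 ≤ R.ne3.Nper ∧ 0 ≤ R.ne3.b ∧ 0 ≤ c' ∧ R.ne3.b ≤ t ∧ c' ≤ t ∧ 0 ≤ R.ne3.C ∧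
        (2 : ℝ) ^ 91 * (R.ne3.L : ℝ) ^ 17 * t ≤ 1 ∧ (2 : ℝ) ^ 76 * (R.ne3.L : ℝ) ^ 12 * t ≤ R.ne3.ε ∧
        16 * B7Prop2Explicit.C0 4 * R.ne3.ε ≤ 3 ∧ 1024 * (4 + 1) * (4 + 4) * (R.ne3.L : ℝ) ^ 2 * R.ne3.ε ≤ 1 ∧
        ε₁ ≤ 1 / 4 ∧ ε₁ ≤ R.ne3.b ∧ 4 * ε₁ ≤ c' ∧ R.ne3.dom ⊆ sfClass 4 R.ne3.L R.ne3.Nper ε₁ 0 ∧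
        LeafH3sup 4 R.ne3.L R.ne3.Nper R.ne3.ε R.ne3.b c' R.ne3.dom ∧
        (∀ V ∈ R.ne3.dom, ∀ k : ℕ, IsMinimiser 4 (sfClass 4 R.ne3.L R.ne3.Nper R.ne3.ε) R.ne3.L R.ne3.Nper k V (sel k V)) ∧
        (∀ V ∈ R.ne3.dom, ∀ k : ℕ, RegularSup 4 R.ne3.L R.ne3.Nper R.ne3.b c' k (sel k V)) ∧
        0 < θ ∧ θ ^ 6 = ((R.ne3.L : ℝ))⁻¹ ∧ 0 < R.ne3.Λ₂' ∧ 0 < γ₃ ∧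
        R.ne3.C * (wallConst 4 R.ne3.L * (R.ne3.Nper : ℝ) ^ 2 *
          (Real.sqrt (gradConst 4 c') * dualC2 4 R.ne3.L + 2 * R.ne3.b ^ 2 * dualC1 4 R.ne3.L)) ≤ γ₃ ^ 3 ∧
        0 < l₁ ∧ R.ne3.Λ₁ ≤ l₁ ^ 3 ∧ γ₃ * θ ^ 2 ≤ l₁ * R.ne3.Nper ∧ θ ^ ((3 : ℝ) * β - 2) ≤ θ₃ ∧ θ₃ < 1 ∧
        (∀ v ∈ Rd.dom, rd v ∈ R.ne3.dom) ∧
        (∀ k, ∀ v ∈ Rd.dom, Rd.act k v = minAct 4 (sfClass 4 R.ne3.L R.ne3.Nper R.ne3.ε) R.ne3.L R.ne3.Nper k (rd v)) ∧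
        (R.ne3.Nper : ℝ) ^ 4 ≤ Rd.vol ∧ 1 ≤ k₀ ∧
        (∀ K : ℕ, ∀ v ∈ Rd.dom, ∀ (u : B7Prop1Explicit.Site 4 → (Matrix (Fin N) (Fin N) ℂ)ˣ)
          (Z : B7Prop1Explicit.Site 4 → Fin 4 → Matrix (Fin N) (Fin N) ℂ) (M : ℝ),
          IsUnitarySite u → IsPeriodicSite u ((R.ne3.Nper * R.ne3.L ^ (k₀ + K) : ℕ) : ℤ) → T4AveragingDeficitWall.IsSkewDir Z →
          IsPeriodicDir Z ((R.ne3.Nper * R.ne3.L ^ (k₀ + K) : ℕ) : ℤ) →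
          B7Prop1Explicit.gaugeAct u (sel (k₀ + K) (rd v)) =
            T4AveragingDeficitWall.vary (B7Prop2Explicit.rescale R.ne3.L (B7Prop1Explicit.bavg R.ne3.L (sel (k₀ + K + 1) (rd v)))) Z 1 →
          (∀ (x : B7Prop1Explicit.Site 4) (κ : Fin 4), (R.ne3.L : ℝ) ^ (k₀ + K) * ‖Z x κ‖ ≤ M) →
          (∀ (x : B7Prop1Explicit.Site 4) (μ κ : Fin 4), ((R.ne3.L : ℝ) ^ (k₀ + K)) ^ 2 *
              ‖T4AveragingDeficitWall.Ad (B7Prop2Explicit.rescale R.ne3.L (B7Prop1Explicit.bavg R.ne3.L (sel (k₀ + K + 1) (rd v)))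
                  (x + B7Prop1Explicit.e κ) μ) (Z (x + B7Prop1Explicit.e μ) κ) - Z x κ‖ ≤ M) →
          R.u3.C.gauge (uA K v) (R.u3.C.transport (uB K v)) ≤ M) ∧
        -- (v′-17) N17 BY NAME, what is left of it: the β-window, the smallness window, rates (run identification ∕ infrared pin ∕ box are the pin's)
        0 < bβ ∧ EventualLowerH bβ R.u3.γ k₀β D.βfun ∧
        R.u3.cr * R.u3.C₉ * R.u3.ω * (((k₀β : ℝ) + 1) * R.u3.γ ^ 3 + 2 * R.u3.γ / bβ) ≤ (1 - R.u3.ρ) / 2 ∧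
        0 < R.u3.ρ ∧ R.u3.ρ ≤ θc ∧
        -- the bracket (T) IN THE TUBE CURRENCY, what is left of it: the (1.18) real bound; the pair-disc shape at the printed tube radius κ₁·α(C₁, q₁, s_j)
        -- ((2.27)(ii)(iv) through the (1.13)∕(2.39) tube — SHAPE, NODE O); signs (the upper running and both window memberships are the pin's)
        DecayBound R.u3.EA R.u3.W E₀T R.u3.κ ∧
        (∀ s ∈ R.u3.W, ∀ (X : R.u3.C.Dom) (U U' : R.u3.C.BgA),
          R.u3.C.gauge U U' < κ₁T * B14.alphaJ C₁T q₁ (s (R.u3.C.scale X)) →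
          ∃ f : ℂ → ℂ, DifferentiableOn ℂ f (Metric.ball (0 : ℂ) (κ₁T * B14.alphaJ C₁T q₁ (s (R.u3.C.scale X)))) ∧
            f 0 = (R.u3.EA s U X : ℂ) ∧ f (R.u3.C.gauge U U' : ℂ) = (R.u3.EA s U' X : ℂ) ∧
            ∀ z ∈ Metric.ball (0 : ℂ) (κ₁T * B14.alphaJ C₁T q₁ (s (R.u3.C.scale X))),
              ‖f z‖ ≤ E₀T * Real.exp (-(R.u3.κ * R.u3.C.d X))) ∧
        0 ≤ E₀T ∧ 0 < κ₁T ∧ 0 < C₁T ∧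
        -- selector compatibility
        (∀ s ∈ R.u3.W, 0 < bsel s ∧ bsel s ≤ R.u3.γ))

include hβ1 hlink

/-- ★★ **N19′'s EDGE GIVEN K3⁷ v2's RATES PREDICATE ON TUNED BARE SEQUENCES, MODULO THE LINK READING AT THE RUNS OF RECORD** [bookkeeping]: at every guarded
admissible Stage-13 tuple, every bare sequence `g₀` TUNED to `gIR` within `]0, γ]`, `γ ≤ θ.γ` ([Balaban1987RG1] Thm 2 p. 259's renormalisation condition at the
datum of record — a HYPOTHESIS), with `β ≤ b′` ALONG ITS RUNS OF RECORD (K1⁷'s window; a HYPOTHESIS), every `os`, run length `k`: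
`RatesHolderAt D R β ∧ ReadOutAt D R.u3 ∧ (0 ≤ R.u3.ρ ∧ R.u3.ρ < 1) → ∃ δ, NE7.Core (cr …) … δ ∧ Summable δ` for `R := rateCarriersOfRecord₁₃CoPH 𝔯 F θ hP g₀ os k`,
`D := datumOfRecord₁₃CoPH F N θ hP`.  Proof: E `N19RateEdgeHolder.rateEdge_of_linkReading_byName_pairDiscC1Holder` at the same-tuple pair predicate carrying the
slot's `ReadOutAt`, `ρ < 1` (as J) AND the tuning, `γ ≤ θ.γ`, the along-history bound; its «v9» obligation is REASSEMBLED from `hlink` (J's reading with `g`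
PINNED to the window-extended runs of record), J's seven named facts (three letter signs from (D4), `0 < γ` from admissibility, `2 ≤ L` from the family,
(T)'s window clause from `θ.γ² ≤ e⁻¹`) and the SEVEN run clauses of §1 at the pinned `g` — (0.20) along the runs of record being this seat's
`rgEqH_runFlow_datumOfRecord₁₃CoPH_of_tuned` (the datum HALTS OUTSIDE; no β letter), `β′_T := max b′ 0`.  NOT NE7; N19 NOT discharged; `hlink` (NODE O's world
at the runs of record + the remaining in-edge letters) DISPLAYED. -/
theorem h19HolderD4_datumOfRecord₁₃CoPH_of_linkReadingAtRuns_tuned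
    (F : T4Family) (θ : Stage13HParams F N) (hP : θ.Provisos₁₃CoPH F N) (hG : G θ) (hθ : θ.Admissible F N) {γ gIR b' : ℝ} {g₀ : ℕ → ℝ}
    (ht : (datumOfRecord₁₃CoPH F N θ hP).Tuned γ gIR g₀) (hγle : γ ≤ θ.γ)
    (halong : ∀ K i, i < K →
      (datumOfRecord₁₃CoPH F N θ hP).βfun i (prefixOf (runFlow (datumOfRecord₁₃CoPH F N θ hP) g₀ K) i) ≤ b')
    (os : List (ULoop F)) (k : ℕ)
    (hP4 : RatesHolderAt (datumOfRecord₁₃CoPH F N θ hP) (rateCarriersOfRecord₁₃CoPH 𝔯 F θ hP g₀ os k) β ∧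
      ReadOutAt (datumOfRecord₁₃CoPH F N θ hP) (rateCarriersOfRecord₁₃CoPH 𝔯 F θ hP g₀ os k).u3 ∧
      (0 ≤ (rateCarriersOfRecord₁₃CoPH 𝔯 F θ hP g₀ os k).u3.ρ ∧ (rateCarriersOfRecord₁₃CoPH 𝔯 F θ hP g₀ os k).u3.ρ < 1)) :
    letI := (cr F θ hP g₀ os).dec
    ∃ δ : ℕ → ℝ, NE7.Core (cr F θ hP g₀ os).l₀ (cr F θ hP g₀ os).vol (cr F θ hP g₀ os).T (cr F θ hP g₀ os).Bad
      (fun K t τ => (cr F θ hP g₀ os).A K t τ - (cr F θ hP g₀ os).shA K t τ) (fun K t τ => (cr F θ hP g₀ os).B K t τ - (cr F θ hP g₀ os).shB K t τ) δ ∧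
      Summable δ :=
  rateEdge_of_linkReading_byName_pairDiscC1Holder
    (fun F D g₀ os S R => ∃ (θ : Stage13HParams F N) (hP : θ.Provisos₁₃CoPH F N) (k : ℕ) (γ gIR b' : ℝ), G θ ∧ θ.Admissible F N ∧
      D = datumOfRecord₁₃CoPH F N θ hP ∧ S = cr F θ hP g₀ os ∧ R = rateCarriersOfRecord₁₃CoPH 𝔯 F θ hP g₀ os k ∧ ReadOutAt D R.u3 ∧ R.u3.ρ < 1 ∧
      (datumOfRecord₁₃CoPH F N θ hP).Tuned γ gIR g₀ ∧ γ ≤ θ.γ ∧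
      ∀ K i, i < K → (datumOfRecord₁₃CoPH F N θ hP).βfun i (prefixOf (runFlow (datumOfRecord₁₃CoPH F N θ hP) g₀ K) i) ≤ b')
    hβ1 (by
      rintro F D g₀ os S R ⟨θ, hP, k, γ, gIR, b', hG, hθ, rfl, rfl, rfl, hD4, hρ1, ht, hγle, halong⟩
      -- destructure the reading at the runs of record IN STAGES (as E and J), then reassemble v9's clause
      obtain ⟨hγe, iDom, F', ι', X', iMeas, L, Rd, bsel, EB, θc, θ₃, g, uA, uB, hrest⟩ := hlink F θ hP hG hθ γ gIR g₀ ht hγle os k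
      obtain ⟨Pf, d₀, L₀, Koff, cells, H033, I, fam, Lb, βw, κ₁, Gv, Cl, K₁, Λ₀, N₀, dressed, iDr, hrest⟩ := hrest
      obtain ⟨c', t, ε₁, ϑ, γ₃, l₁, sel, rd, k₀, bβ, k₀β, E₀T, κ₁T, C₁T, q₁, hrest⟩ := hrest
      obtain ⟨hgle, hggt, hEB, hL, hvol, homult, hCw, hΛg, hθΛ, hPd, hPL, hPK, hcard, hκ₀, hdom, hinj, hlen, hrest⟩ := hrest
      obtain ⟨h11, hβw1, hβw0, hLb, hGv, hCl, hcount, hN₀, hΛ₀, hle, hidA, hidB, hidD, hrest⟩ := hrest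
      obtain ⟨hg3, hNper, hb, hc', hbt, hct, hC3, hsmall3, hεt, hε1, hε2, hε₁, hε₁b, hε₁c, hdom3, hH3, hsel, hreg, hrest⟩ := hrest
      obtain ⟨hθ0, hθ6, hΛ₂', hγ₃, hγ3, hl₁, hΛl₁, hfit, hθ₃θ, hθ₃1, hrd, hact, hvol3, hk₀, hdomC1, hrest⟩ := hrest
      obtain ⟨hbβ, hlo, hsmallβ, hρ0, hρθc, hdecT, hdiscT, hE₀T, hκ₁T, hC₁T, hbsel⟩ := hrest
      have hsg := signs_rateCarriersOfRecord₁₃CoPH_of_readOutAt 𝔯 θ hP g₀ os k hD4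
      -- the SEVEN run clauses at the PINNED runs: (0.20) along the runs of record is the datum's guard (this seat's g0, no β letter), the rest §1
      have hrg := rgEqH_runFlow_datumOfRecord₁₃CoPH_of_tuned θ hP ht
      obtain ⟨hrun, hpin, hbox, hgA, hgB, -, -⟩ := runClauses_of_pinnedRuns_tuned (datumOfRecord₁₃CoPH F N θ hP) hrg ht hγle hgle hggt
      have hup := invSq_of_pinnedRuns_along (datumOfRecord₁₃CoPH F N θ hP) hrg halong ht hgle
      refine ⟨iDom, F', ι', X', iMeas, L, Rd, bsel, EB, θc, θ₃, g, uA, uB, Pf, d₀, L₀, Koff, cells, H033, I, fam, Lb, βw, κ₁, Gv, Cl, K₁, Λ₀, N₀,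
        dressed, iDr, c', t, ε₁, ϑ, γ₃, l₁, sel, rd, k₀, gIR, bβ, k₀β, E₀T, κ₁T, C₁T, max b' 0, q₁, hEB, hL, hvol, homult, hCw, hΛg, hθΛ, hPd, hPL,
        hPK, hcard, hκ₀, hdom, hinj, hlen, h11, hβw1, hβw0, hLb, hGv, hCl, hcount, hN₀, hΛ₀, hle, hidA, hidB, hidD, ?_⟩
      exact ⟨hg3, two_le_ne3_L_rateCarriersOfRecord₁₃CoPH 𝔯 θ hP g₀ os k, hNper, hb, hc', hbt, hct, hC3, hsmall3, hεt, hε1, hε2, hε₁, hε₁b, hε₁c,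
        hdom3, hH3, hsel, hreg, hθ0, hθ6, hΛ₂', hγ₃, hγ3, hl₁, hΛl₁, hfit, hθ₃θ, hθ₃1, hrd, hact, hvol3, hk₀, hdomC1,
        hsg.1, hsg.2.1, hsg.2.2, hrun, hpin, hD4, hbβ, hlo, hsmallβ, hρ0, hρ1, gamma_pos_rateCarriersOfRecord₁₃CoPH 𝔯 θ hP hθ g₀ os k, hρθc, hbox,
        hdecT, hdiscT, hE₀T, hκ₁T, hC₁T, window_rateCarriersOfRecord₁₃CoPH_sq_le_exp_neg_one 𝔯 θ hP g₀ os k hγe, hup, le_max_right _ _, hgA, hgB,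
        hbsel⟩)
    F _ g₀ os _ _ ⟨θ, hP, k, γ, gIR, b', hG, hθ, rfl, rfl, rfl, hP4.2.1, hP4.2.2.2, ht, hγle, halong⟩ hP4.1

/-! ## §3 UNDER THE CRUX's PREFIX BY NAME: `ForSmallCouplings (datumOfRecord₁₃CoPH F N θ hP) (fun g₀ => ∀ os k, PHolderD4 → ∃ δ, NE7.Core … δ ∧ Summable δ)` -/

/-- ★★ **N19′'s SLOT UNDER THE `ForSmallCouplings` PREFIX, MODULO THE LINK READING AT THE RUNS OF RECORD** [bookkeeping]: at every guarded admissible Stage-13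
tuple carrying K1⁷'s interval-form β-window `BetaBoundsInInterval D.C.toB12 γ₀ b b′` (N24's binder at the ₁₃ record, [Balaban1987RG1] (1.22) p. 264 upper half ∕
UNPRINTED lower half — a HYPOTHESIS; only its upper half is read, through this seat's `betaAlong_runFlow_le_of_betaBoundsInInterval`): FOR ALL SMALL COUPLINGS —
threshold `γ₀′ := min γ₀ θ.γ`, the `g`-threshold idle, `ForSmallCouplings` BY NAME — every `os`, run length `k`: `PHolderD4 β D R → ∃ δ, NE7.Core (cr …) … δ ∧ Summable δ`.
This is the `g₀`-clause of J's slot theorem restricted to the prefix the K3⁷ item's conclusion `HybridNE7Under` and its extraction slot live under; (B) and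
`EndpointExistence` are not used.  NOT NE7; N19 NOT discharged; NOT a proof of `stub_expansion13H` (whose N19′ slot quantifies over every `g₀`). -/
theorem forSmallCouplings_h19HolderD4_datumOfRecord₁₃CoPH_of_linkReadingAtRuns
    (F : T4Family) (θ : Stage13HParams F N) (hP : θ.Provisos₁₃CoPH F N) (hG : G θ) (hθ : θ.Admissible F N) {γ₀ b b' : ℝ} (hγ₀ : 0 < γ₀)
    (hβ : DagBinding.BetaBoundsInInterval (datumOfRecord₁₃CoPH F N θ hP).C.toB12 γ₀ b b') :
    ForSmallCouplings (datumOfRecord₁₃CoPH F N θ hP) fun g₀ => ∀ (os : List (ULoop F)) (k : ℕ),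
      (RatesHolderAt (datumOfRecord₁₃CoPH F N θ hP) (rateCarriersOfRecord₁₃CoPH 𝔯 F θ hP g₀ os k) β ∧
        ReadOutAt (datumOfRecord₁₃CoPH F N θ hP) (rateCarriersOfRecord₁₃CoPH 𝔯 F θ hP g₀ os k).u3 ∧
        (0 ≤ (rateCarriersOfRecord₁₃CoPH 𝔯 F θ hP g₀ os k).u3.ρ ∧ (rateCarriersOfRecord₁₃CoPH 𝔯 F θ hP g₀ os k).u3.ρ < 1)) →
      letI := (cr F θ hP g₀ os).dec
      ∃ δ : ℕ → ℝ, NE7.Core (cr F θ hP g₀ os).l₀ (cr F θ hP g₀ os).vol (cr F θ hP g₀ os).T (cr F θ hP g₀ os).Bad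
        (fun K t τ => (cr F θ hP g₀ os).A K t τ - (cr F θ hP g₀ os).shA K t τ) (fun K t τ => (cr F θ hP g₀ os).B K t τ - (cr F θ hP g₀ os).shB K t τ) δ ∧
        Summable δ := by
  refine ⟨min γ₀ θ.γ, lt_min hγ₀ hθ.toStage9.gamma_pos, fun γ _ hγle => ⟨1, one_pos, fun gIR _ _ g₀ ht os k hP4 => ?_⟩⟩
  exact h19HolderD4_datumOfRecord₁₃CoPH_of_linkReadingAtRuns_tuned cr 𝔯 G hβ1 hlink F θ hP hG hθ ht (hγle.trans (min_le_right _ _))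
    (fun K i hi => betaAlong_runFlow_le_of_betaBoundsInInterval _ hβ (hγle.trans (min_le_left _ _)) (ht K).1 i hi) os k hP4

/-- ★ **K3⁷ v2's N19′ SLOT TEXT UNDER THE PREFIX** (`KeyedCoreEdgeHolderD4 β cr (rrOfRecord 𝔯 ks)`'s `g₀ os`-clause, UNFOLDED — the skeleton's `def`s are local to
it — for a run-length selector `ks`, restricted to `ForSmallCouplings`): §3 at `k := ks F θ hP g₀ os`.  At `N = 2`, `G := θ.ZhUnity F 2 ∧ θ.SlotsNondegenerate₁₃ F 2`,
`cr := crOfRecord₁₃(V)At …` this is the slot's body under the prefix, modulo `hlink` and K1⁷'s window; NOT a proof of stub 2; NOT NE7. [bookkeeping] -/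
theorem forSmallCouplings_keyedCoreEdgeHolderD4_of_linkReadingAtRuns
    (ks : (F : T4Family) → (θ : Stage13HParams F N) → θ.Provisos₁₃CoPH F N → (ℕ → ℝ) → List (ULoop F) → ℕ)
    (F : T4Family) (θ : Stage13HParams F N) (hP : θ.Provisos₁₃CoPH F N) (hG : G θ) (hθ : θ.Admissible F N) {γ₀ b b' : ℝ} (hγ₀ : 0 < γ₀)
    (hβ : DagBinding.BetaBoundsInInterval (datumOfRecord₁₃CoPH F N θ hP).C.toB12 γ₀ b b') :
    ForSmallCouplings (datumOfRecord₁₃CoPH F N θ hP) fun g₀ => ∀ (os : List (ULoop F)),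
      (RatesHolderAt (datumOfRecord₁₃CoPH F N θ hP) (rateCarriersOfRecord₁₃CoPH 𝔯 F θ hP g₀ os (ks F θ hP g₀ os)) β ∧
        ReadOutAt (datumOfRecord₁₃CoPH F N θ hP) (rateCarriersOfRecord₁₃CoPH 𝔯 F θ hP g₀ os (ks F θ hP g₀ os)).u3 ∧
        (0 ≤ (rateCarriersOfRecord₁₃CoPH 𝔯 F θ hP g₀ os (ks F θ hP g₀ os)).u3.ρ ∧
          (rateCarriersOfRecord₁₃CoPH 𝔯 F θ hP g₀ os (ks F θ hP g₀ os)).u3.ρ < 1)) →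
      letI := (cr F θ hP g₀ os).dec
      ∃ δ : ℕ → ℝ, NE7.Core (cr F θ hP g₀ os).l₀ (cr F θ hP g₀ os).vol (cr F θ hP g₀ os).T (cr F θ hP g₀ os).Bad
        (fun K t τ => (cr F θ hP g₀ os).A K t τ - (cr F θ hP g₀ os).shA K t τ) (fun K t τ => (cr F θ hP g₀ os).B K t τ - (cr F θ hP g₀ os).shB K t τ) δ ∧
        Summable δ :=
  (forSmallCouplings_h19HolderD4_datumOfRecord₁₃CoPH_of_linkReadingAtRuns cr 𝔯 G hβ1 hlink F θ hP hG hθ hγ₀ hβ).mono fun g₀ h os =>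
    h os (ks F θ hP g₀ os)

end AtRecordRuns

end Summit.QuantumFields.YangMills.BalabanUVNodes.N19RateEdgeHolderD4AtRuns

end
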